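import Literature.Computability.MetaComplexity.GraphOrderingPrincipleDegree
import Literature.Computability.MetaComplexity.PolynomialCalculusResidueProperties
import HarnessLib

/-!
# `GOP(G)`: vertices of monomials, critical truth assignments, local solution sets (Galesi–Lauria 2010, §3)

Bookkeeping for the reproduction of Galesi–Lauria's degree lower bound (ACM ToCL 2010, Thm 1) for
their graph ordering principle `GOP(G)` (`GOP.glGOP G`, file `GraphOrderingPrincipleDegree.lean`;
variables `x_{a,b} = var n a b = a·n + b` for `a < b`, read "`a ≺ b`"):

* `GOP.vtx n j` — the vertices mentioned by the variable with index `j` (`{a, b}` for `x_{a,b}`;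
  GL10's `Vertex(·)`), `GOP.Vtx n s` — the vertices of a monomial;
* `GOP.cta n u` — the `u`-CRITICAL TRUTH ASSIGNMENT as a restriction (GL10 p. 11: "`ρ` sets `u` as
  a global minimum": `x_{a,u} := 0` for `a < u`, `x_{u,a} := 1` for `u < a`; every other variable
  index mentioning `u` — none occurs in `GOP(G)` — is set to `0`), and its effect on the literals
  "`a ≺ b`" (`GOP.precLit`);
* `GOP.locSol G I` — the common Boolean roots of `T ∪ {M_w : w ∈ I}` (the set the residues
  `R_{T,M_I}` of GL10 are taken relative to), `GOP.locSol_empty_nonempty` ("`T` is satisfiable");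
* **`GOP.ovr_cta_mem_locSol`** — the heart of GL10 Lemma 5: if `x` is a common root of
  `T ∪ M_J`, `u ∉ I` and every `w ∈ I ∖ J` is a neighbour of `u`, then the `u`-cta override of `x`
  is a common root of `T ∪ M_I` ("any equation in `T` containing `u` is satisfied by `ρ` …
  `M_I|_ρ ⊆ M_{I - {v}}` since `ρ` is setting to `0` at least `M_v`");
* the axioms of `GOP(G)` as polynomials: their vertices (`GOP.Vtx_subset_of_transClause`,
  `GOP.Vtx_subset_of_minClause`) and their vanishing on `locSol`.

Source: N. Galesi, M. Lauria, *Optimality of size-degree tradeoffs for polynomial calculus*, ACM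
ToCL 12(1) (2010), §3 pp. 7–12 [GalesiLauria2010] (held copy `paper:doi-10-1145-1838552-1838556`).
-/

noncomputable section

namespace Literature.Computability.MetaComplexity

namespace GOP

open Finset MvPolynomial Literature.Computability.Complexity PCResidue

variable {n : ℕ}

/-! ### Vertices of variables and monomials -/

/-- The vertices mentioned by the variable with index `j` (`Vertex(x_{a,b}) = {a, b}`; for an
index that is not a variable of `GOP(G)` whatever `j / n`, `j % n` name). [Galesi–Lauria 2010, §3
("`Vertex(p)` the set of vertices mentioned in the variables occurring in `p`")]
[cite: GalesiLauria2010, §3] -/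
def vtx (n : ℕ) (j : ℕ) : Finset (Fin n) := Finset.univ.filter fun a => a.val = j / n ∨ a.val = j % n

/-- Membership in `vtx`. [Galesi–Lauria 2010, §3] [cite: GalesiLauria2010, §3] -/
theorem mem_vtx {j : ℕ} {a : Fin n} : a ∈ vtx n j ↔ a.val = j / n ∨ a.val = j % n := by
  simp [vtx]

/-- `var n a b / n = a` and `var n a b % n = b`. [folklore] -/
theorem var_div_mod (a b : Fin n) : var n a b / n = a.val ∧ var n a b % n = b.val := by
  have hb := b.isLt
  have hn : 0 < n := lt_of_le_of_lt (Nat.zero_le _) hb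
  unfold var
  constructor
  · rw [show a.val * n + b.val = b.val + a.val * n by ring, Nat.add_mul_div_right _ _ hn,
      Nat.div_eq_of_lt hb, zero_add]
  · rw [show a.val * n + b.val = b.val + a.val * n by ring, Nat.add_mul_mod_self_right,
      Nat.mod_eq_of_lt hb]

/-- `Vertex(x_{a,b}) = {a, b}`. [Galesi–Lauria 2010, §3] [cite: GalesiLauria2010, §3] -/
theorem mem_vtx_var {a b u : Fin n} : u ∈ vtx n (var n a b) ↔ u = a ∨ u = b := by
  rw [mem_vtx, (var_div_mod a b).1, (var_div_mod a b).2, Fin.ext_iff, Fin.ext_iff]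

/-- `a ∈ vtx (var n a b)`. [folklore] -/
theorem left_mem_vtx_var (a b : Fin n) : a ∈ vtx n (var n a b) := mem_vtx_var.2 (Or.inl rfl)

/-- `b ∈ vtx (var n a b)`. [folklore] -/
theorem right_mem_vtx_var (a b : Fin n) : b ∈ vtx n (var n a b) := mem_vtx_var.2 (Or.inr rfl)

/-- The vertices of a monomial: `Vertex(t)`. [Galesi–Lauria 2010, §3] [cite: GalesiLauria2010, §3] -/
def Vtx (n : ℕ) (s : ℕ →₀ ℕ) : Finset (Fin n) := s.support.biUnion (vtx n)

/-- Membership in `Vtx`. [Galesi–Lauria 2010, §3] [cite: GalesiLauria2010, §3] -/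
theorem mem_Vtx {s : ℕ →₀ ℕ} {u : Fin n} : u ∈ Vtx n s ↔ ∃ j ∈ s.support, u ∈ vtx n j := by
  simp [Vtx]

/-- A variable mentions at most two vertices. [Galesi–Lauria 2010, proof of Lemma 3]
[cite: GalesiLauria2010, Lemma 3] -/
theorem card_vtx_le (j : ℕ) : (vtx n j).card ≤ 2 := by
  classical
  have h : vtx n j ⊆ (Finset.univ.filter fun a : Fin n => a.val = j / n) ∪
      (Finset.univ.filter fun a : Fin n => a.val = j % n) := by
    intro a ha; rw [mem_vtx] at ha; simp [ha]
  have h1 : ∀ m : ℕ, (Finset.univ.filter fun a : Fin n => a.val = m).card ≤ 1 := fun m => by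
    refine Finset.card_le_one.2 fun a ha b hb => ?_
    simp only [Finset.mem_filter, Finset.mem_univ, true_and] at ha hb
    exact Fin.ext (ha.trans hb.symm)
  have := (Finset.card_le_card h).trans (Finset.card_union_le _ _)
  have ha := h1 (j / n); have hb := h1 (j % n)
  omega

/-- "The number of vertices appearing in term `t` is at most twice the degree of `t`" (here: twice
the number of its variables). [Galesi–Lauria 2010, proof of Lemma 3] [cite: GalesiLauria2010, Lemma 3] -/
theorem card_Vtx_le (s : ℕ →₀ ℕ) : (Vtx n s).card ≤ 2 * s.support.card := by
  rw [Vtx, mul_comm]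
  exact Finset.card_biUnion_le_card_mul _ _ _ fun j _ => card_vtx_le j

/-- `Vtx` is monotone in the variable set. [folklore] -/
theorem Vtx_mono {s t : ℕ →₀ ℕ} (h : s.support ⊆ t.support) : Vtx n s ⊆ Vtx n t :=
  Finset.biUnion_subset_biUnion_of_subset_left _ h

/-- The vertices of the (single) monomial of `monomial s a`. [folklore] -/
theorem Vtx_subset_of_mem_support_monomial {K : Type*} [Field K] {s t : ℕ →₀ ℕ} {a : K}
    (ht : t ∈ (monomial s a).support) : Vtx n t ⊆ Vtx n s := by
  classical
  rw [Finset.mem_singleton.1 (support_monomial_subset ht)]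

/-- Adding the variable `x_j` to a monomial adds `j` to its variables. [folklore] -/
theorem support_add_single (t : ℕ →₀ ℕ) (j : ℕ) :
    (t + Finsupp.single j 1).support = insert j t.support := by
  classical
  ext i
  simp only [Finsupp.mem_support_iff, Finsupp.add_apply, Finsupp.single_apply, Finset.mem_insert]
  by_cases h : j = i
  · subst h; simp
  · simp [h, Ne.symm h]

/-- Degree bookkeeping: `|Vertex(x_j t)| ≤ 2(|t| + 1) ≤ cr/2` when `deg t + 1 ≤ d ≤ cr/4`.
[Galesi–Lauria 2010, proof of Lemma 3 / Theorem 1] [cite: GalesiLauria2010, Theorem 1] -/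
theorem card_Vtx_add_single_le {r : ℕ} {c : ℝ} {d : ℕ} (hd : (d : ℝ) ≤ c * r / 4) {t : ℕ →₀ ℕ}
    (ht : (t.sum fun _ e => e) + 1 ≤ d) (j : ℕ) :
    ((Vtx n (t + Finsupp.single j 1)).card : ℝ) ≤ c * r / 2 := by
  classical
  have h1 := card_Vtx_le (n := n) (t + Finsupp.single j 1)
  have h2 : (t + Finsupp.single j 1).support.card ≤ t.support.card + 1 := by
    rw [support_add_single]; exact Finset.card_insert_le _ _
  have h3 : t.support.card ≤ t.sum fun _ e => e := by
    rw [MLPC.sum_exponents_eq_degree]; exact MLPC.card_support_le_degree t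
  have h4 : ((Vtx n (t + Finsupp.single j 1)).card : ℝ) ≤ 2 * d := by
    have : (Vtx n (t + Finsupp.single j 1)).card ≤ 2 * d := by omega
    exact_mod_cast this
  linarith

/-! ### Critical truth assignments -/

/-- The `u`-CRITICAL TRUTH ASSIGNMENT as a restriction: every variable index mentioning `u` is
set, `x_{u,a} := 1` (`u < a`) and all others (`x_{a,u}`, `a < u`, and non-`GOP` indices) `:= 0` —
"`ρ` sets `u` as a global minimum and leaves unassigned all other variables". [Galesi–Lauria 2010,
§3 p. 11 (u-cta)] [cite: GalesiLauria2010, §3 (u-cta)] -/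
def cta (n : ℕ) (u : Fin n) : ℕ → Option Bool := fun j =>
  if u ∈ vtx n j then some (decide (j / n = u.val ∧ u.val < j % n)) else none

/-- The u-cta leaves exactly the variables not mentioning `u` unassigned. [Galesi–Lauria 2010,
§3 p. 11] [cite: GalesiLauria2010, §3 (u-cta)] -/
theorem cta_eq_none_iff {u : Fin n} {j : ℕ} : cta n u j = none ↔ u ∉ vtx n j := by
  unfold cta; split_ifs with h <;> simp [h]

/-- Under the u-cta, a variable not mentioning `u` keeps its value. [Galesi–Lauria 2010, §3 p. 11]
[cite: GalesiLauria2010, §3 (u-cta)] -/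
theorem ovr_cta_of_notMem {u : Fin n} {j : ℕ} (h : u ∉ vtx n j) (x : ℕ → Bool) :
    ovr (cta n u) x j = x j :=
  ovr_of_none (cta_eq_none_iff.2 h) x

/-- Under the u-cta, `x_{u,b} = 1` for `u < b`. [Galesi–Lauria 2010, §3 p. 11]
[cite: GalesiLauria2010, §3 (u-cta)] -/
theorem ovr_cta_var_left {u b : Fin n} (hub : u < b) (x : ℕ → Bool) :
    ovr (cta n u) x (var n u b) = true := by
  refine ovr_of_some ?_ x
  rw [cta, if_pos (left_mem_vtx_var u b), (var_div_mod u b).1, (var_div_mod u b).2]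
  simp [hub]

/-- Under the u-cta, `x_{a,u} = 0` for `a < u`. [Galesi–Lauria 2010, §3 p. 11]
[cite: GalesiLauria2010, §3 (u-cta)] -/
theorem ovr_cta_var_right {a u : Fin n} (hau : a < u) (x : ℕ → Bool) :
    ovr (cta n u) x (var n a u) = false := by
  refine ovr_of_some ?_ x
  rw [cta, if_pos (right_mem_vtx_var a u), (var_div_mod a u).1]
  have : a.val ≠ u.val := Fin.val_ne_of_ne (Fin.ne_of_lt hau)
  simp [this]

/-- Under the u-cta, `x_{a,b}` is unchanged when `u ∉ {a, b}`. [Galesi–Lauria 2010, §3 p. 11]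
[cite: GalesiLauria2010, §3 (u-cta)] -/
theorem ovr_cta_var_of_ne {a b u : Fin n} (ha : a ≠ u) (hb : b ≠ u) (x : ℕ → Bool) :
    ovr (cta n u) x (var n a b) = x (var n a b) :=
  ovr_cta_of_notMem (fun h => by rcases mem_vtx_var.1 h with rfl | rfl <;> simp_all) x

/-- The literal "`u ≺ b`" is TRUE under the u-cta (`u` is a global minimum). [Galesi–Lauria 2010,
§3 p. 11] [cite: GalesiLauria2010, §3 (u-cta)] -/
theorem eval_precLit_cta_left {u b : Fin n} (hb : b ≠ u) (x : ℕ → Bool) :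
    (precLit n u b).eval (ovr (cta n u) x) = true := by
  unfold precLit
  rcases lt_or_gt_of_ne hb with h | h
  · rw [if_neg (not_lt.2 h.le), Literal.eval, ovr_cta_var_right h]; rfl
  · rw [if_pos h, Literal.eval, ovr_cta_var_left h]; rfl

/-- The literal "`a ≺ u`" is FALSE under the u-cta. [Galesi–Lauria 2010, §3 p. 11]
[cite: GalesiLauria2010, §3 (u-cta)] -/
theorem eval_precLit_cta_right {a u : Fin n} (ha : a ≠ u) (x : ℕ → Bool) :
    (precLit n a u).eval (ovr (cta n u) x) = false := by
  unfold precLit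
  rcases lt_or_gt_of_ne ha with h | h
  · rw [if_pos h, Literal.eval, ovr_cta_var_right h]; rfl
  · rw [if_neg (not_lt.2 h.le), Literal.eval, ovr_cta_var_left h]; rfl

/-- A literal "`a ≺ b`" not mentioning `u` is unchanged under the u-cta. [Galesi–Lauria 2010,
§3 p. 11] [cite: GalesiLauria2010, §3 (u-cta)] -/
theorem eval_precLit_cta_of_ne {a b u : Fin n} (ha : a ≠ u) (hb : b ≠ u) (x : ℕ → Bool) :
    (precLit n a b).eval (ovr (cta n u) x) = (precLit n a b).eval x := by
  unfold precLit
  split_ifs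
  · rw [Literal.eval, Literal.eval, ovr_cta_var_of_ne ha hb]
  · rw [Literal.eval, Literal.eval, ovr_cta_var_of_ne hb ha]

/-! ### Local solution sets -/

variable (G : SimpleGraph (Fin n)) [DecidableRel G.Adj]

/-- The common Boolean roots of `T ∪ {M_w : w ∈ I}`: assignments satisfying every no-3-cycle
clause and the non-minimality clause of every `w ∈ I` (the zero set the residues `R_{T,M_I}` are
taken modulo). [Galesi–Lauria 2010, §3 (`R_{T,M_I}`)] [cite: GalesiLauria2010, §3] -/
def locSol (I : Finset (Fin n)) : Set (ℕ → Bool) :=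
  {x | (∀ C ∈ transClauses n, C.eval x = true) ∧ ∀ w ∈ I, (minClause G w).eval x = true}

variable {G}

/-- Fewer non-minimality axioms, more common roots. [folklore] -/
theorem locSol_mono {I J : Finset (Fin n)} (h : J ⊆ I) : locSol G I ⊆ locSol G J :=
  fun _ hx => ⟨hx.1, fun w hw => hx.2 w (h hw)⟩

/-- Membership in `transClauses`. [Galesi–Lauria 2010, §3 (2)–(3)] [cite: GalesiLauria2010, §3] -/
theorem mem_transClauses {C : Clause ℕ} : C ∈ transClauses n ↔
    ∃ a b c : Fin n, a < b ∧ b < c ∧ (C = transClause₁ n a b c ∨ C = transClause₂ n a b c) := by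
  simp only [transClauses, List.mem_flatMap, List.mem_finRange, true_and]
  constructor
  · rintro ⟨a, b, c, h⟩
    refine ⟨a, b, c, ?_⟩
    split_ifs at h with hlt
    · simp only [List.mem_cons, List.not_mem_nil, or_false] at h
      exact ⟨hlt.1, hlt.2, h⟩
    · simp at h
  · rintro ⟨a, b, c, hab, hbc, h⟩
    refine ⟨a, b, c, ?_⟩
    rw [if_pos ⟨hab, hbc⟩]
    rcases h with rfl | rfl <;> simp

/-- "`T` is satisfiable": the natural order (all `x_{a,b} = 1`) is a common root of `T`.
[Galesi–Lauria 2010, proof of Lemma 2, Requirement 3] [cite: GalesiLauria2010, Lemma 2] -/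
theorem locSol_empty_nonempty : (locSol G ∅).Nonempty := by
  refine ⟨fun _ => true, fun C hC => ?_, fun w hw => absurd hw (Finset.notMem_empty w)⟩
  obtain ⟨a, b, c, -, -, h⟩ := mem_transClauses.1 hC
  rcases h with rfl | rfl <;> simp [transClause₁, transClause₂, Clause.eval, Literal.eval]

/-- The no-3-cycle clauses survive the u-cta ("any equation in `T` containing the vertex `u` is
satisfied by `ρ`. Any other equation in `T` is not touched"). [Galesi–Lauria 2010, proof of
Lemma 5] [cite: GalesiLauria2010, Lemma 5] -/
theorem eval_transClause_cta {C : Clause ℕ} (hC : C ∈ transClauses n) (u : Fin n) {x : ℕ → Bool}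
    (hx : C.eval x = true) : C.eval (ovr (cta n u) x) = true := by
  obtain ⟨a, b, c, hab, hbc, h⟩ := mem_transClauses.1 hC
  have hac : a < c := hab.trans hbc
  -- values of the three variables under the override
  have key : ∀ {p q : Fin n}, p < q → ovr (cta n u) x (var n p q) =
      if p = u then true else if q = u then false else x (var n p q) := by
    intro p q hpq
    split_ifs with hp hq
    · subst hp; exact ovr_cta_var_left hpq x
    · subst hq; exact ovr_cta_var_right hpq x
    · exact ovr_cta_var_of_ne hp hq x
  rcases h with rfl | rfl
  · simp only [transClause₁, Clause.eval, List.any_cons, List.any_nil, Bool.or_false, Literal.eval,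
      Bool.or_eq_true, beq_iff_eq] at hx ⊢
    rw [key hab, key hbc, key hac]
    by_cases ha : a = u
    · simp [ha]
    by_cases hb : b = u
    · subst hb; simp [ha]
    by_cases hc : c = u
    · subst hc; simp [ha, hb]
    simpa [ha, hb, hc] using hx
  · simp only [transClause₂, Clause.eval, List.any_cons, List.any_nil, Bool.or_false, Literal.eval,
      Bool.or_eq_true, beq_iff_eq] at hx ⊢
    rw [key hab, key hbc, key hac]
    by_cases ha : a = u
    · simp [ha]
    by_cases hb : b = u
    · subst hb; simp [ha]
    by_cases hc : c = u
    · subst hc; simp [ha, hb]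
    simpa [ha, hb, hc] using hx

/-- `M_w` as a disjunction over the neighbours of `w`. [Galesi–Lauria 2010, §3 (4)]
[cite: GalesiLauria2010, §3] -/
theorem eval_minClause_eq_true {w : Fin n} {x : ℕ → Bool} :
    (minClause G w).eval x = true ↔ ∃ a, G.Adj w a ∧ (precLit n a w).eval x = true := by
  simp [minClause, Clause.eval, List.any_eq_true]

/-- A neighbour of `u` is not minimal under the u-cta (`M_w|_ρ = 0` for `w ∈ Γ(u)`).
[Galesi–Lauria 2010, proof of Lemma 5 ("`ρ` is setting to `0` at least `M_v`")]
[cite: GalesiLauria2010, Lemma 5] -/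
theorem eval_minClause_cta_of_adj {u w : Fin n} (h : G.Adj u w) (x : ℕ → Bool) :
    (minClause G w).eval (ovr (cta n u) x) = true :=
  eval_minClause_eq_true.2 ⟨u, h.symm, eval_precLit_cta_left (G.ne_of_adj h).symm x⟩

/-- A satisfied `M_w`, `w ≠ u`, stays satisfied under the u-cta. [Galesi–Lauria 2010, proof of
Lemma 5 ("`M_I|_ρ ⊆ M_{I-{v}}`")] [cite: GalesiLauria2010, Lemma 5] -/
theorem eval_minClause_cta_of_ne {u w : Fin n} (hw : w ≠ u) {x : ℕ → Bool}
    (hx : (minClause G w).eval x = true) : (minClause G w).eval (ovr (cta n u) x) = true := by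
  obtain ⟨a, hadj, ha⟩ := eval_minClause_eq_true.1 hx
  by_cases hau : a = u
  · subst hau; exact eval_minClause_cta_of_adj hadj.symm x
  · exact eval_minClause_eq_true.2 ⟨a, hadj, by rwa [eval_precLit_cta_of_ne hau hw]⟩

/-- **The u-cta maps common roots of `T ∪ M_J` to common roots of `T ∪ M_I`** whenever `u ∉ I`
and every `w ∈ I ∖ J` is a neighbour of `u` (GL10 Lemma 5 uses `J = I - {v}` with `{u, v}` an
edge; Lemma 7 uses `J = I`). [Galesi–Lauria 2010, Lemmas 5 and 7] [cite: GalesiLauria2010, Lemma 5] -/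
theorem ovr_cta_mem_locSol {I J : Finset (Fin n)} {u : Fin n} (hu : u ∉ I)
    (hIJ : ∀ w ∈ I, w ∉ J → G.Adj u w) {x : ℕ → Bool} (hx : x ∈ locSol G J) :
    ovr (cta n u) x ∈ locSol G I := by
  refine ⟨fun C hC => eval_transClause_cta hC u (hx.1 C hC), fun w hw => ?_⟩
  by_cases hwJ : w ∈ J
  · exact eval_minClause_cta_of_ne (fun h : w = u => hu (h ▸ hw)) (hx.2 w hwJ)
  · exact eval_minClause_cta_of_adj (hIJ w hw hwJ) x

/-! ### The axioms as polynomials: vertices and vanishing -/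

variable {K : Type*} [Field K]

/-- The variables of a clause polynomial are variables of its literals. [Krajíček 2019, (6.0.1)]
[folklore] -/
theorem exists_of_mem_vars_ofClause {C : Clause ℕ} {j : ℕ} (hj : j ∈ (PC.ofClause K C).vars) :
    ∃ l ∈ C, l.1 = j := by
  classical
  induction C with
  | nil => simp [PC.ofClause_nil] at hj
  | cons l C ih =>
    rw [PC.ofClause_cons] at hj
    rcases Finset.mem_union.1 (vars_mul _ _ hj) with h | h
    · refine ⟨l, by simp, ?_⟩
      unfold PC.ofLiteral at h
      split_ifs at h
      · have := vars_sub_subset (p := (1 : MvPolynomial ℕ K)) (q := X l.1) h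
        rw [vars_one, Finset.empty_union, vars_X, Finset.mem_singleton] at this
        exact this.symm
      · rw [vars_X, Finset.mem_singleton] at h; exact h.symm
    · obtain ⟨l', hl', h'⟩ := ih h
      exact ⟨l', by simp [hl'], h'⟩

/-- The vertices of a monomial of a clause polynomial are vertices of the clause's literals.
[Galesi–Lauria 2010, §3] [cite: GalesiLauria2010, §3] -/
theorem mem_Vtx_of_mem_support_ofClause {C : Clause ℕ} {s : ℕ →₀ ℕ}
    (hs : s ∈ (PC.ofClause K C).support) {u : Fin n} (hu : u ∈ Vtx n s) :
    ∃ l ∈ C, u ∈ vtx n l.1 := by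
  obtain ⟨j, hj, huj⟩ := mem_Vtx.1 hu
  obtain ⟨l, hl, rfl⟩ := exists_of_mem_vars_ofClause ((mem_vars_iff_mem_support j).2 ⟨s, hs, hj⟩)
  exact ⟨l, hl, huj⟩

/-- `Vertex` of a monomial of a no-3-cycle axiom: inside `{a, b, c}`. [Galesi–Lauria 2010, §3]
[cite: GalesiLauria2010, §3] -/
theorem Vtx_subset_of_transClause {a b c : Fin n} {C : Clause ℕ}
    (hC : C = transClause₁ n a b c ∨ C = transClause₂ n a b c) {s : ℕ →₀ ℕ}
    (hs : s ∈ (PC.ofClause K C).support) : Vtx n s ⊆ {a, b, c} := by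
  intro u hu
  obtain ⟨l, hl, hul⟩ := mem_Vtx_of_mem_support_ofClause hs hu
  have : l.1 = var n a b ∨ l.1 = var n b c ∨ l.1 = var n a c := by
    rcases hC with rfl | rfl
    · simp only [transClause₁, List.mem_cons, List.not_mem_nil, or_false] at hl
      rcases hl with rfl | rfl | rfl <;> simp
    · simp only [transClause₂, List.mem_cons, List.not_mem_nil, or_false] at hl
      rcases hl with rfl | rfl | rfl <;> simp
  rcases this with h | h | h <;> rw [h, mem_vtx_var] at hul <;> rcases hul with rfl | rfl <;> simp

/-- `Vertex` of a monomial of `M_w`: inside `{w} ∪ Γ(w)`. [Galesi–Lauria 2010, §3]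
[cite: GalesiLauria2010, §3] -/
theorem Vtx_subset_of_minClause {w : Fin n} {s : ℕ →₀ ℕ}
    (hs : s ∈ (PC.ofClause K (minClause G w)).support) :
    Vtx n s ⊆ insert w (G.neighborFinset w) := by
  intro u hu
  obtain ⟨l, hl, hul⟩ := mem_Vtx_of_mem_support_ofClause hs hu
  simp only [minClause, List.mem_map, Finset.mem_sort, SimpleGraph.mem_neighborFinset] at hl
  obtain ⟨a, hadj, rfl⟩ := hl
  unfold precLit at hul
  split_ifs at hul <;> rw [mem_vtx_var] at hul <;> rcases hul with rfl | rfl <;> simp [hadj]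

/-- A satisfied clause polynomial vanishes. [Krajíček 2019, (6.0.1)] [folklore] -/
theorem bval_ofClause_eq_zero {C : Clause ℕ} {x : ℕ → Bool} (h : C.eval x = true) :
    bval x (PC.ofClause K C) = 0 := by
  change MvPolynomial.eval (fun v => if x v then (1 : K) else 0) (PC.ofClause K C) = 0
  rw [PC.eval_ofClause, if_pos h]

/-- A no-3-cycle axiom vanishes on every local solution set. [Galesi–Lauria 2010, §3]
[cite: GalesiLauria2010, §3] -/
theorem bval_ofClause_transClause {C : Clause ℕ} (hC : C ∈ transClauses n) {I : Finset (Fin n)}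
    {x : ℕ → Bool} (hx : x ∈ locSol G I) : bval x (PC.ofClause K C) = 0 :=
  bval_ofClause_eq_zero (hx.1 C hC)

/-- `M_w` vanishes on the local solution set of any `I ∋ w`. [Galesi–Lauria 2010, §3]
[cite: GalesiLauria2010, §3] -/
theorem bval_ofClause_minClause {w : Fin n} {I : Finset (Fin n)} (hw : w ∈ I) {x : ℕ → Bool}
    (hx : x ∈ locSol G I) : bval x (PC.ofClause K (minClause G w)) = 0 :=
  bval_ofClause_eq_zero (hx.2 w hw)

end GOP

end Literature.Computability.MetaComplexity
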